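import Literature.MathematicalPhysics.QuantumFieldTheory.Balaban1983to89.B9SectBStepWhole
import Literature.MathematicalPhysics.QuantumFieldTheory.Balaban1983to89.B9PinCarriersKLevelV1

/-!
# `Balaban1983to89.B9BaseU1OfSectC` — a LOCATED fact about the typed skeleton of [B9] Sects. A–C: the induction base
# `U = 1` of Cor. 3.5 (`B9.BaseU1Printed`, hence the N06 knit's twelve `U = 1` obligations — the eight comparisons against
# [4], the two null readings, the residual entries `ResidualGpAtOne` ∕ `ResidualGAGlobAtOne`) IS THE `U = 1` INSTANCE of the
# conclusions of Theorems 3.1–3.3, which the knit already derives for every regular `U` from the Sect.-C leaves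
# (Thms 3.7, 3.9, 3.10 + the two summation leaves); kernel-checked, with the knit at the Stage-3′(Y) bundle re-run on it

T. Bałaban, *Propagators for lattice gauge theories in a background field*, Commun. Math. Phys. **99** (1985) 389–434
[`Balaban1985BackgroundPropagators`, "B9"]; [4] = T. Bałaban, *Propagators and renormalization transformations for lattice
gauge theories. II*, Commun. Math. Phys. **96** (1984) 223–250 [`Balaban1984PropagatorsII`].

statement-level skeleton of published theorems with citation tags; proofs where landed; nothing here is a claim about the
Yang–Mills mass gap

THE PRINTED LOCI (verbatim).  Cor. 3.5 p. 407: *"This allows us to prove Theorems 3.1–3.3 in some special situations, where we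
can use the results of [4]. There we have proved these theorems for operators with the external gauge field configuration
U = 1."*; Theorem 3.1 p. 397: *"for M ≧ M₁ and for an arbitrary configuration U satisfying the regularity condition (3.35) with
Mα₀ ≦ a₀, the operator G′(U) (a = 1) satisfies the inequalities"* (3.42)–(3.47); Theorem 3.2 (3.48), Theorem 3.3 (the same for
G(U)); p. 410: *"Theorem 3.7 implies that all the inequalities (3.42)–(3.47) hold for G′, thus we have completed the proof of
Theorem 3.1"*; p. 413: *"This theorem implies Theorem 3.2"*; p. 416: *"From (3.108) it follows that the expansion (3.107) is
convergent in all norms in the inequalities (3.42)–(3.47)"*.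

THE LOCATED FACT.  `U ≡ 1` satisfies (3.35) for EVERY α₀ > 0 (A = 0; the knit's `hone`, at the record `reg335Y_one`).  Hence the
typed Theorem 3.1 `B9.Thm31Printed c35 geo bg K` — «∃ M₁ δ₀ a₀ B₀ …, ∀ i, M ≧ M₁ → ∀ α₀ > 0, Mα₀ ≦ a₀ → ∀ U (3.35)-regular →
(3.42)–(3.47) for K(U)» — SPECIALISES at `U := 1`, `α₀ := a₀∕M`, to «∃ M₁ B₀ δ₀ …, ∀ i, M ≧ M₁ → (3.42)–(3.47) for K(1)»; likewise
Theorem 3.2 for the kernel bound (3.48) at U = 1.  In the knit (`B9LeafKnit.b9LeafX_of_leaves`, `B9.sectsAC_architecture`)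
Theorems 3.1–3.3 are DERIVED from the Sect.-C leaves: `B9.thm31_of_thm37` (Thm 3.7 + the summation leaf `RWSumsYieldIneqs`),
`B9.thm32_of_thm39` (Thm 3.9 + `RWKernelSumYields`), `B9.thm33_of_thm37_310`.  THEREFORE, in the typed skeleton:
  (a) `B9FromB6.ResidualGpAtOne geo bg Gp` ⇐ `Thm37Printed` + `RWSumsYieldIneqs` (+ `hone`)  — N06-ASSIGNMENT row 11 ⇐ t37 + row 19;
  (b) `B9FromB6.ResidualGAGlobAtOne geo bg GA` (indeed ALL five U = 1 blocks of G) ⇐ `Thm310Printed` + `RWSumsYieldIneqs` — row 12 ⇐ rows 18–19;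
  (c) the WHOLE base `B9.BaseU1Printed d geo bg Gp GA Cinv` ⇐ Thm 3.7 + 3.9 + 3.10 + the two summation leaves (+ `hone` + the sign facts
      of (3.39)–(3.41) for merging constants) — rows 1–12 (and the [4] block the `U = 1` edge consumes) ⇐ t37 + rows 15, 16, 18, 19;
  (d) the N06 leaf `B9LeafX` at def-Y's bundle `carriersY … ops` from the SIXTEEN whole-statement leaves + the Sect.-B step + the
      gauge reduction ALONE (`b9LeafX_carriersY_of_sectC`): the twelve `U = 1` binders and the [B6] block of
      `B9PinCarriersKLevelV1.b9LeafX_carriersY` drop out.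
HONEST READING OF (a)–(d).  This is bookkeeping on the TYPED node, not mathematics of [B9]: in PRINT the logical order is the
opposite — the U = 1 base ([4]) ⇒ Cor. 3.5 ⇒ Cor. 3.6 ⇒ the local inputs of Thm 3.7 ∕ 3.9 ∕ 3.10 (p. 409) ⇒ Thms 3.1–3.3 for
all U; the typed leaves `Thm37Printed`, `RWSumsYieldIneqs`, … carry Cor. 3.6's local inequalities INSIDE their own hypotheses
of printed shape (`B9.sectsAC_architecture` docstring: «recorded, not re-derived»; n06-c's `B9Thm37Whole.Local342`).  So (a)–(d)
say: the `U = 1` rows of the N06 census are NOT independent obligations of the typed knit — they close the hour the Sect.-C rows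
close — and, conversely (LOCATED), whoever discharges the Sect.-C leaves at a pin must not import the `U = 1` residual entries it
is used here to derive (no cycle in the typed DAG: the leaves are hypotheses; the cycle would be in a proof that fed (a) back into
row 19).  The [B6] in-edge of N06 (N03's block) remains print's route to the base and the knit of record
(`b9LeafX_carriersY`); (d) is the alternative face, not a replacement.

* §1 Theorems 3.1 ∕ 3.2 AT U = 1: `blocksAtOne_of_thm31`, `kerAtOne_of_thm32`; Thm 3.1's shape for G from Thm 3.10 + the summation
  leaf: `thm31_of_thm310_sums`; both components of Thm 3.3: `thm31_pair_of_thm33`.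
* §2 (a), (b): `residualGpAtOne_of_thm31`, `residualGAGlobAtOne_of_thm31`, ★ `residualGpAtOne_of_thm37_sums`, ★ `residualGAGlobAtOne_of_thm310_sums`,
  `residualGpAtOne_GA_of_thm310_sums` (all five blocks of G(1)).
* §3 (c): ★ `baseU1Printed_of_thm31_32` (Thm 3.1 for G′ and for G + Thm 3.2 at U = 1, constants merged under `ModelSignsOn`), ★
  `baseU1Printed_of_sectC`.
* §4 (d) at the Stage-3′(Y) carriers over def-Y's signature `ops : ∀ x, OperatorLayerY … x` (`hone := reg335Y_one`, signs := dag-n03-b's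
  `modelSignsOn_geo9K`, `hc := c35Y_pos`): ★ `hGp_of_t37_hsum`, ★ `hGA_of_t310_hsum`, ★ `baseU1_carriersY_of_sectC`, ★ `b9LeafX_carriersY_of_sectC`.

HONEST SCOPE.  Nothing of [B9] or [4] asserted; every input is a typed leaf taken as hypothesis; count-neutral; NOT a node
discharge (it lowers the number of INDEPENDENT displayed obligations of the typed knit, it proves none of them); one finite lattice
programme — nothing continuum, nothing about the mass gap.  Cell `pub-ymgap` (HUMAN RULING D-0062), Track A node N06 [B9],
N06-ASSIGNMENT v1 rows 11–12 (bundle F3), seat `pub-ymgap-dag-n06-h`, 2026-08-26.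
-/

noncomputable section

namespace Literature.MathematicalPhysics.QuantumFieldTheory.Balaban1983to89.B9BaseU1OfSectC

open B9FromB6 B9FromB6ModelSignsOn B9SectBStepWhole
open B9PinMembersKLevelV1 (MemberY geo9Y bg9Y reg335Y_one)
open B9PinGeometryKLevelV1 (dOmegaY OmKY inΛY unitDistY InCubeY c35Y c35Y_pos)
open B9PinCarriersKLevelV1 (OperatorLayerY carriersY)
open DagBinding (B9LeafX)

/-! ## §1 Theorems 3.1 ∕ 3.2 at `U = 1` -/

section AtOne

variable {I : Type} {d : ℕ} {c35 : ℝ} {geo : I → B9.Geometry} {bg : I → B9.Backgrounds}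

/-- **THEOREM 3.1 AT U = 1** (above its threshold): `U ≡ 1` being in the class (3.35) for every α₀ > 0 (`hone`), the typed Theorem 3.1 for
a family `K` gives all of (3.42)–(3.47) for K(1) at every member with M ≧ M₁ (α₀ := a₀∕M).
[cite: Balaban1985BackgroundPropagators, Thm 3.1 pp.397–398 + Cor. 3.5 p.407] -/
theorem blocksAtOne_of_thm31 {K : ∀ i, B9.KernelFamily (geo i) (bg i)}
    (hone : ∀ (i : I) (α₀ : ℝ), 0 < α₀ → (bg i).Reg335 c35 α₀ (bg i).one) (h31 : B9.Thm31Printed c35 geo bg K) :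
    ∃ M₁ δ₀ B₀ : ℝ, ∃ Bβ Bε : ℝ → ℝ, ∃ Bεβ : ℝ → ℝ → ℝ, 0 < M₁ ∧ 0 < δ₀ ∧ 0 < B₀ ∧
      ∀ i : I, M₁ ≤ (geo i).M →
        B9.Ineq342_346_347 (K i) B₀ δ₀ (bg i).one ∧ B9.Ineq343_345 (K i) Bβ Bε Bεβ δ₀ (bg i).one := by
  obtain ⟨M₁, δ₀, a₀, B₀, Bβ, Bε, Bεβ, hM₁, hδ₀, ha₀, hB₀, H⟩ := h31
  refine ⟨M₁, δ₀, B₀, Bβ, Bε, Bεβ, hM₁, hδ₀, hB₀, fun i hi => ?_⟩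
  have hM : 0 < (geo i).M := hM₁.trans_le hi
  have hα : 0 < a₀ / (geo i).M := div_pos ha₀ hM
  have hMa : (geo i).M * (a₀ / (geo i).M) ≤ a₀ := le_of_eq (mul_div_cancel₀ a₀ hM.ne')
  exact H i hi _ hα hMa _ (hone i _ hα)

/-- **THEOREM 3.2 AT U = 1**: the kernel bound (3.48) for (Q′G′²Q′*)⁻¹(1) at every member with M ≧ M₁.
[cite: Balaban1985BackgroundPropagators, Thm 3.2 (3.48) p.398 + Cor. 3.5 p.407] -/
theorem kerAtOne_of_thm32 {Cinv : ∀ i, B9.SiteKernel (geo i) (bg i)}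
    (hone : ∀ (i : I) (α₀ : ℝ), 0 < α₀ → (bg i).Reg335 c35 α₀ (bg i).one) (h32 : B9.Thm32Printed d c35 geo bg Cinv) :
    ∃ M₁ δ₁ B₁ : ℝ, 0 < M₁ ∧ 0 < δ₁ ∧ 0 < B₁ ∧ ∀ i : I, M₁ ≤ (geo i).M → ∀ y y' : (geo i).Site,
      |(Cinv i).ker (bg i).one y y'| ≤
        B₁ * ((geo i).len y) ^ (-(4 : ℝ)) * ((geo i).len y') ^ (-(d : ℝ)) * Real.exp (-(δ₁ * (geo i).dist y y')) := by
  obtain ⟨M₁, δ₁, a₀, B₁, hM₁, hδ₁, ha₀, hB₁, H⟩ := h32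
  refine ⟨M₁, δ₁, B₁, hM₁, hδ₁, hB₁, fun i hi => ?_⟩
  have hM : 0 < (geo i).M := hM₁.trans_le hi
  have hα : 0 < a₀ / (geo i).M := div_pos ha₀ hM
  have hMa : (geo i).M * (a₀ / (geo i).M) ≤ a₀ := le_of_eq (mul_div_cancel₀ a₀ hM.ne')
  exact H i hi _ hα hMa _ (hone i _ hα)

/-- **Theorem 3.1's SHAPE FOR G from Theorem 3.10 + the summation leaf** (p. 416: *"From (3.108) it follows that the expansion
(3.107) is convergent in all norms in the inequalities (3.42)–(3.47)"*): `Thm310Printed` gives the convergence of (3.107) under the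
provisos, `RWSumsYieldIneqs`' second clause turns it into (3.42)–(3.47) for G(U) — the G-half of `B9.thm33_of_thm37_310`, which
needs no Thm 3.7. [cite: Balaban1985BackgroundPropagators, Thm 3.10 pp.415–416 + Thm 3.3 p.399] -/
theorem thm31_of_thm310_sums {E7 E10 : ∀ i, B9.RWExpansion (geo i) (bg i)} {Gp GA : ∀ i, B9.KernelFamily (geo i) (bg i)}
    (t310 : B9.Thm310Printed c35 geo bg E10) (hsum : B9.RWSumsYieldIneqs geo bg E7 E10 Gp GA) : B9.Thm31Printed c35 geo bg GA := by
  obtain ⟨M₂, a₀, δ₃, C, c, hM₂, ha₀, -, -, -, H⟩ := t310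
  obtain ⟨B₀, δ₀, Bβ, Bε, Bεβ, hB, hδ, S⟩ := hsum
  exact ⟨M₂, δ₀, a₀, B₀, Bβ, Bε, Bεβ, hM₂, hδ, ha₀, hB, fun i hMi α₀ hα hMa U hU => (S i U).2 (H i hMi α₀ hα hMa U hU).1⟩

/-- Both components of the typed Theorem 3.3 in Theorem 3.1's shape (same constants). [cite: Balaban1985BackgroundPropagators, Thm 3.3 p.399 (bookkeeping)] -/
theorem thm31_pair_of_thm33 {Gp GA : ∀ i, B9.KernelFamily (geo i) (bg i)} (h33 : B9.Thm33Printed c35 geo bg Gp GA) :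
    B9.Thm31Printed c35 geo bg Gp ∧ B9.Thm31Printed c35 geo bg GA := by
  obtain ⟨M₁, δ₀, a₀, B₀, Bβ, Bε, Bεβ, hM₁, hδ₀, ha₀, hB₀, H⟩ := h33
  exact ⟨⟨M₁, δ₀, a₀, B₀, Bβ, Bε, Bεβ, hM₁, hδ₀, ha₀, hB₀, fun i hi α₀ hα hMa U hU => (H i hi α₀ hα hMa U hU).1⟩,
    ⟨M₁, δ₀, a₀, B₀, Bβ, Bε, Bεβ, hM₁, hδ₀, ha₀, hB₀, fun i hi α₀ hα hMa U hU => (H i hi α₀ hα hMa U hU).2⟩⟩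

end AtOne

/-! ## §2 The residual entries of the `U = 1` edge from the Sect.-C leaves -/

section Residual

variable {I : Type} {c35 : ℝ} {geo : I → B9.Geometry} {bg : I → B9.Backgrounds}

/-- **`ResidualGpAtOne geo bg K` FROM THEOREM 3.1 FOR `K` AT U = 1** — the five residual blocks (3.46), (3.47), (3.43)Δ̃, (3.44), (3.45)
of K(1) are five of Theorem 3.1's six at U = 1. [cite: Balaban1985BackgroundPropagators, Thm 3.1 pp.397–398 + Cor. 3.5 p.407] -/
theorem residualGpAtOne_of_thm31 {K : ∀ i, B9.KernelFamily (geo i) (bg i)}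
    (hone : ∀ (i : I) (α₀ : ℝ), 0 < α₀ → (bg i).Reg335 c35 α₀ (bg i).one) (h31 : B9.Thm31Printed c35 geo bg K) :
    ResidualGpAtOne geo bg K := by
  obtain ⟨M₁, δ₀, B₀, Bβ, Bε, Bεβ, hM₁, hδ₀, hB₀, H⟩ := blocksAtOne_of_thm31 hone h31
  refine ⟨M₁, B₀, δ₀, Bβ, Bε, Bεβ, hM₁, hB₀, hδ₀, fun i hi => ?_⟩
  obtain ⟨⟨-, hL2, hG⟩, hH1, hE4, hH2⟩ := H i hi
  exact ⟨hL2, hG, hH1, hE4, hH2⟩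

/-- **`ResidualGAGlobAtOne geo bg K` FROM THEOREM 3.1 FOR `K` AT U = 1** (the (3.47) block of K(1)).
[cite: Balaban1985BackgroundPropagators, Thm 3.1 (3.47) p.398 + Cor. 3.5 p.407] -/
theorem residualGAGlobAtOne_of_thm31 {K : ∀ i, B9.KernelFamily (geo i) (bg i)}
    (hone : ∀ (i : I) (α₀ : ℝ), 0 < α₀ → (bg i).Reg335 c35 α₀ (bg i).one) (h31 : B9.Thm31Printed c35 geo bg K) :
    ResidualGAGlobAtOne geo bg K := by
  obtain ⟨M₁, δ₀, B₀, Bβ, Bε, Bεβ, hM₁, hδ₀, hB₀, H⟩ := blocksAtOne_of_thm31 hone h31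
  exact ⟨M₁, B₀, hM₁, hB₀, fun i hi => (H i hi).1.2.2⟩

variable {E7 E10 : ∀ i, B9.RWExpansion (geo i) (bg i)} {Gp GA : ∀ i, B9.KernelFamily (geo i) (bg i)}

/-- ★ **(a) THE KNIT's `hGp` FROM ITS `t37` AND `hsum`**: `ResidualGpAtOne geo bg Gp` ⇐ `Thm37Printed c35 geo bg E7` + `RWSumsYieldIneqs
geo bg E7 E10 Gp GA` + `hone` (`B9.thm31_of_thm37` at U = 1).  N06-ASSIGNMENT row 11 ⇐ t37 (pinned) + row 19.
[cite: Balaban1985BackgroundPropagators, Thm 3.7 ⇒ Thm 3.1 p.410 + Cor. 3.5 p.407] -/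
theorem residualGpAtOne_of_thm37_sums (hone : ∀ (i : I) (α₀ : ℝ), 0 < α₀ → (bg i).Reg335 c35 α₀ (bg i).one)
    (t37 : B9.Thm37Printed c35 geo bg E7) (hsum : B9.RWSumsYieldIneqs geo bg E7 E10 Gp GA) : ResidualGpAtOne geo bg Gp :=
  residualGpAtOne_of_thm31 hone (B9.thm31_of_thm37 c35 geo bg E7 E10 Gp GA t37 hsum)

/-- ★ **(b) THE KNIT's `hGA` FROM ITS `t310` AND `hsum`**: `ResidualGAGlobAtOne geo bg GA` ⇐ `Thm310Printed c35 geo bg E10` +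
`RWSumsYieldIneqs geo bg E7 E10 Gp GA` + `hone`.  N06-ASSIGNMENT row 12 ⇐ rows 18–19.
[cite: Balaban1985BackgroundPropagators, Thm 3.10 ⇒ Thm 3.3 p.416 + Cor. 3.5 p.407] -/
theorem residualGAGlobAtOne_of_thm310_sums (hone : ∀ (i : I) (α₀ : ℝ), 0 < α₀ → (bg i).Reg335 c35 α₀ (bg i).one)
    (t310 : B9.Thm310Printed c35 geo bg E10) (hsum : B9.RWSumsYieldIneqs geo bg E7 E10 Gp GA) : ResidualGAGlobAtOne geo bg GA :=
  residualGAGlobAtOne_of_thm31 hone (thm31_of_thm310_sums t310 hsum)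

/-- … indeed ALL FIVE U = 1 residual-shape blocks of G(1) (not only (3.47)) from `t310` + `hsum` + `hone`.
[cite: Balaban1985BackgroundPropagators, Thm 3.10 ⇒ Thm 3.3 p.416 + Cor. 3.5 p.407] -/
theorem residualGpAtOne_GA_of_thm310_sums (hone : ∀ (i : I) (α₀ : ℝ), 0 < α₀ → (bg i).Reg335 c35 α₀ (bg i).one)
    (t310 : B9.Thm310Printed c35 geo bg E10) (hsum : B9.RWSumsYieldIneqs geo bg E7 E10 Gp GA) : ResidualGpAtOne geo bg GA :=
  residualGpAtOne_of_thm31 hone (thm31_of_thm310_sums t310 hsum)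

end Residual

/-! ## §3 The whole `U = 1` base from Theorems 3.1 ∕ 3.2 ∕ 3.3 at `U = 1` -/

section Base

variable {I : Type} {d : ℕ} {c35 : ℝ} {geo : I → B9.Geometry} {bg : I → B9.Backgrounds} {Q : ∀ i, (geo i).Loc → Prop}
  {Gp GA : ∀ i, B9.KernelFamily (geo i) (bg i)} {Cinv : ∀ i, B9.SiteKernel (geo i) (bg i)}

/-- ★ **(c) `B9.BaseU1Printed` FROM THEOREM 3.1 FOR G′ AND FOR G AND THEOREM 3.2, AT U = 1**: thresholds merged by max, the shared
constants of G′ and G by max ∕ min ∕ pointwise max floored at `0` (n06-c's `ineq342_346_347_mono`, `ineq343_345_mono` under the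
sign facts `ModelSignsOn (geo i) (Q i)` of (3.39)–(3.41), ANY `Q`); each theorem applied with its OWN α₀ = a₀∕M, which `hone` allows.
[cite: Balaban1985BackgroundPropagators, Thms 3.1–3.3 pp.397–399 + Cor. 3.5 p.407] -/
theorem baseU1Printed_of_thm31_32 (S : ∀ i, ModelSignsOn (geo i) (Q i))
    (hone : ∀ (i : I) (α₀ : ℝ), 0 < α₀ → (bg i).Reg335 c35 α₀ (bg i).one) (hP : B9.Thm31Printed c35 geo bg Gp)
    (hK : B9.Thm32Printed d c35 geo bg Cinv) (hA : B9.Thm31Printed c35 geo bg GA) : B9.BaseU1Printed d geo bg Gp GA Cinv := by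
  obtain ⟨MP, δP, BP, FβP, FεP, FεβP, hMP, hδP, hBP, HP⟩ := blocksAtOne_of_thm31 hone hP
  obtain ⟨MK, δ₁, B₁, hMK, hδ₁, hB₁, HK⟩ := kerAtOne_of_thm32 hone hK
  obtain ⟨MA, δA, BA, FβA, FεA, FεβA, hMA, hδA, hBA, HA⟩ := blocksAtOne_of_thm31 hone hA
  refine ⟨max (max MP MK) MA, max BP BA, min δP δA, fun β => max 0 (max (FβP β) (FβA β)),
    fun ε => max 0 (max (FεP ε) (FεA ε)), fun ε β => max 0 (max (FεβP ε β) (FεβA ε β)), B₁, δ₁,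
    lt_max_of_lt_right hMA, lt_max_of_lt_left hBP, lt_min hδP hδA, hB₁, hδ₁, fun i hi => ?_⟩
  have hiP : MP ≤ (geo i).M := le_trans (le_trans (le_max_left _ _) (le_max_left _ _)) hi
  have hiK : MK ≤ (geo i).M := le_trans (le_trans (le_max_right _ _) (le_max_left _ _)) hi
  have hiA : MA ≤ (geo i).M := le_trans (le_max_right _ _) hi
  have hB0 : 0 ≤ max BP BA := le_trans hBP.le (le_max_left _ _)
  obtain ⟨hP1, hP2⟩ := HP i hiP
  obtain ⟨hA1, hA2⟩ := HA i hiA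
  refine ⟨⟨ineq342_346_347_mono (S i) hP1 (le_max_left _ _) hB0 (min_le_left _ _),
      ineq343_345_mono (S i) hP2 (fun β => le_trans (le_max_left _ _) (le_max_right _ _)) (fun β => le_max_left _ _)
        (fun ε => le_trans (le_max_left _ _) (le_max_right _ _)) (fun ε => le_max_left _ _)
        (fun ε β => le_trans (le_max_left _ _) (le_max_right _ _)) (fun ε β => le_max_left _ _) (min_le_left _ _)⟩,
    HK i hiK,
    ⟨ineq342_346_347_mono (S i) hA1 (le_max_right _ _) hB0 (min_le_right _ _),
      ineq343_345_mono (S i) hA2 (fun β => le_trans (le_max_right _ _) (le_max_right _ _)) (fun β => le_max_left _ _)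
        (fun ε => le_trans (le_max_right _ _) (le_max_right _ _)) (fun ε => le_max_left _ _)
        (fun ε β => le_trans (le_max_right _ _) (le_max_right _ _)) (fun ε β => le_max_left _ _) (min_le_right _ _)⟩⟩

/-- ★ **(c′) `B9.BaseU1Printed` FROM THE SECT.-C LEAVES** — Thm 3.7 + `RWSumsYieldIneqs` (⇒ Thm 3.1 for G′, `B9.thm31_of_thm37`), Thm 3.9 +
`RWKernelSumYields` (⇒ Thm 3.2, `B9.thm32_of_thm39`), Thm 3.10 + `RWSumsYieldIneqs` (⇒ Thm 3.1's shape for G, `thm31_of_thm310_sums`),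
specialised at U = 1 (`hone`) and merged under the sign facts.  In the N06 knit these are the binders `t37`, `hsum`, `t39`, `hksum`,
`t310`; the conclusion is the `hbase` of `B9LeafKnit.b9LeafX_of_leaves` — so the knit's twelve `U = 1` binders are consequences of
five of its other binders.  LOCATED (see the module docstring): print proves these leaves FROM the base; bookkeeping on the typed
node, no estimate. [cite: Balaban1985BackgroundPropagators, Sects. A–C pp.397–416 (Thm 3.7 ⇒ 3.1 p.410, Thm 3.9 ⇒ 3.2 p.413, Thm 3.10 ⇒ 3.3 p.416) + Cor. 3.5 p.407] -/
theorem baseU1Printed_of_sectC (S : ∀ i, ModelSignsOn (geo i) (Q i))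
    (hone : ∀ (i : I) (α₀ : ℝ), 0 < α₀ → (bg i).Reg335 c35 α₀ (bg i).one)
    {E7 E10 : ∀ i, B9.RWExpansion (geo i) (bg i)} {E9 : ∀ i, B9.RWKernelExpansion (geo i) (bg i)}
    (t37 : B9.Thm37Printed c35 geo bg E7) (t39 : B9.Thm39Printed d c35 geo bg E9) (t310 : B9.Thm310Printed c35 geo bg E10)
    (hsum : B9.RWSumsYieldIneqs geo bg E7 E10 Gp GA) (hksum : B9.RWKernelSumYields d geo bg E9 Cinv) :
    B9.BaseU1Printed d geo bg Gp GA Cinv :=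
  baseU1Printed_of_thm31_32 S hone (B9.thm31_of_thm37 c35 geo bg E7 E10 Gp GA t37 hsum)
    (B9.thm32_of_thm39 d c35 geo bg E9 Cinv t39 hksum) (thm31_of_thm310_sums t310 hsum)

end Base

/-! ## §4 At the Stage-3′(Y) carriers over def-Y's operator-layer signature -/

section StageY

variable {d ℓ : ℕ} {hd : 1 ≤ d + 1} {hL : Odd (ℓ + 1) ∧ 1 < ℓ + 1} {b₀ b₁ : ℝ} {Mstar : ℕ}
variable {𝔸 : Type} [NormedRing 𝔸] [NormedAlgebra ℂ 𝔸] [CompleteSpace 𝔸] [NormOneClass 𝔸] {G : Subgroup 𝔸ˣ}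
variable (ops : ∀ x : MemberY d ℓ hd hL b₀ b₁ Mstar, OperatorLayerY d ℓ hd hL b₀ b₁ Mstar 𝔸 G x)

/-- at the record `U ≡ 1` is in the class (3.35) with O(1) = `c35Y` for every α₀ > 0 — the knit's `hone` (def-Y MODULE 3's `reg335Y_one`).
[cite: Balaban1985BackgroundPropagators, Cor. 3.5 p.407 («U = 1»)] -/
theorem hone_Y (x : MemberY d ℓ hd hL b₀ b₁ Mstar) (α₀ : ℝ) (hα : 0 < α₀) : (bg9Y 𝔸 G x).Reg335 c35Y α₀ (bg9Y 𝔸 G x).one :=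
  reg335Y_one x c35Y_pos hα

/-- ★ **THE KNIT BINDER `hGp` FROM THE KNIT BINDERS `t37`, `hsum`** at def-Y's signature (every operator layer; `hone` discharged).
[cite: Balaban1985BackgroundPropagators, Thm 3.7 ⇒ Thm 3.1 p.410 + Cor. 3.5 p.407] -/
theorem hGp_of_t37_hsum (t37 : B9.Thm37Printed c35Y geo9Y (bg9Y 𝔸 G) (fun x => (ops x).E37))
    (hsum : B9.RWSumsYieldIneqs geo9Y (bg9Y 𝔸 G) (fun x => (ops x).E37) (fun x => (ops x).E310) (fun x => (ops x).Gp)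
      (fun x => (ops x).GA)) :
    ResidualGpAtOne geo9Y (bg9Y 𝔸 G) (fun x => (ops x).Gp) :=
  residualGpAtOne_of_thm37_sums (hone_Y (𝔸 := 𝔸) (G := G)) t37 hsum

/-- ★ **THE KNIT BINDER `hGA` FROM THE KNIT BINDERS `t310`, `hsum`** at def-Y's signature.
[cite: Balaban1985BackgroundPropagators, Thm 3.10 ⇒ Thm 3.3 p.416 + Cor. 3.5 p.407] -/
theorem hGA_of_t310_hsum (t310 : B9.Thm310Printed c35Y geo9Y (bg9Y 𝔸 G) (fun x => (ops x).E310))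
    (hsum : B9.RWSumsYieldIneqs geo9Y (bg9Y 𝔸 G) (fun x => (ops x).E37) (fun x => (ops x).E310) (fun x => (ops x).Gp)
      (fun x => (ops x).GA)) :
    ResidualGAGlobAtOne geo9Y (bg9Y 𝔸 G) (fun x => (ops x).GA) :=
  residualGAGlobAtOne_of_thm310_sums (hone_Y (𝔸 := 𝔸) (G := G)) t310 hsum

/-- ★ **THE `U = 1` BASE AT THE STAGE-3′(Y) CARRIERS FROM THE SECT.-C BINDERS `t37`, `t39`, `t310`, `hsum`, `hksum`** (signs := dag-n03-b's
`modelSignsOn_geo9K`, `hone := reg335Y_one`). [cite: Balaban1985BackgroundPropagators, Sects. A–C pp.397–416 + Cor. 3.5 p.407] -/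
theorem baseU1_carriersY_of_sectC (t37 : B9.Thm37Printed c35Y geo9Y (bg9Y 𝔸 G) (fun x => (ops x).E37))
    (t39 : B9.Thm39Printed (d + 1) c35Y geo9Y (bg9Y 𝔸 G) (fun x => (ops x).EK39))
    (t310 : B9.Thm310Printed c35Y geo9Y (bg9Y 𝔸 G) (fun x => (ops x).E310))
    (hsum : B9.RWSumsYieldIneqs geo9Y (bg9Y 𝔸 G) (fun x => (ops x).E37) (fun x => (ops x).E310) (fun x => (ops x).Gp)
      (fun x => (ops x).GA))
    (hksum : B9.RWKernelSumYields (d + 1) geo9Y (bg9Y 𝔸 G) (fun x => (ops x).EK39) (fun x => (ops x).Cinv)) :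
    B9.BaseU1Printed (d + 1) geo9Y (bg9Y 𝔸 G) (fun x => (ops x).Gp) (fun x => (ops x).GA) (fun x => (ops x).Cinv) :=
  baseU1Printed_of_sectC (fun x => B9GeoNormsKLevelModelSignsV1.modelSignsOn_geo9K x.toKIdx) (hone_Y (𝔸 := 𝔸) (G := G))
    t37 t39 t310 hsum hksum

/-- ★ **(d) THE N06 LEAF AT def-Y's BUNDLE `carriersY … ops` FROM THE SIXTEEN WHOLE-STATEMENT LEAVES, THE SECT.-B STEP AND THE GAUGE
REDUCTION ALONE** — `B9LeafKnit.b9LeafX_of_leaves` with `hbase := baseU1_carriersY_of_sectC`, `hc := c35Y_pos`, `hone := reg335Y_one`: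
compared with def-Y's knit of record `B9PinCarriersKLevelV1.b9LeafX_carriersY`, the twelve `U = 1` binders (`hGp_e … hGA_l2`, `hE4`, `hH2`,
`hGp`, `hGA`) and the [B6] block `h6` DROP OUT.  An ALTERNATIVE FACE of the typed node, located in the module docstring (print's route
to the base is [4], the knit of record keeps it); NOT a discharge: every leaf is a hypothesis. [cite: Balaban1985BackgroundPropagators, Thms 3.1–3.15 pp.397–432; Cor. 3.5 p.407] -/
theorem b9LeafX_carriersY_of_sectC
    (hB : B9.SectBStepPrinted (d + 1) c35Y geo9Y (bg9Y 𝔸 G) (fun x => (ops x).Gp) (fun x => (ops x).GA) (fun x => (ops x).Cinv)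
      (fun x => (ops x).IsAnalyticExt))
    (hg : B9.GaugeReduction335 (d + 1) c35Y geo9Y (bg9Y 𝔸 G) InCubeY (fun x => (ops x).Gp) (fun x => (ops x).GA) (fun x => (ops x).Cinv))
    (t37 : B9.Thm37Printed c35Y geo9Y (bg9Y 𝔸 G) (fun x => (ops x).E37))
    (c38 : B9.Cor38Printed c35Y geo9Y (bg9Y 𝔸 G) (fun x => (ops x).E37))
    (t39 : B9.Thm39Printed (d + 1) c35Y geo9Y (bg9Y 𝔸 G) (fun x => (ops x).EK39))
    (t310 : B9.Thm310Printed c35Y geo9Y (bg9Y 𝔸 G) (fun x => (ops x).E310))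
    (hsum : B9.RWSumsYieldIneqs geo9Y (bg9Y 𝔸 G) (fun x => (ops x).E37) (fun x => (ops x).E310) (fun x => (ops x).Gp) (fun x => (ops x).GA))
    (hksum : B9.RWKernelSumYields (d + 1) geo9Y (bg9Y 𝔸 G) (fun x => (ops x).EK39) (fun x => (ops x).Cinv))
    (t311 : B9.Thm311Printed c35Y geo9Y (bg9Y 𝔸 G) (fun x => (ops x).PosDef))
    (t312 : B9.Thm312Printed (d + 1) c35Y geo9Y (bg9Y 𝔸 G) (fun x => (ops x).GD) (fun x => (ops x).G₁) (fun x => (ops x).H)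
      (fun x => (ops x).H₁) (fun x => (ops x).HasRWExp) (fun x => (ops x).HasRWExpH) (fun x => (ops x).PosDefK))
    (t313 : B9.Thm313Printed c35Y geo9Y (bg9Y 𝔸 G) (fun x => (ops x).GG) (fun x => (ops x).HasRWExp) (fun x => (ops x).PosDefK))
    (t314 : B9.Thm314Printed c35Y geo9Y (bg9Y 𝔸 G) (fun x => (ops x).Kdiff) dOmegaY)
    (t315 : B9.Thm315FullPrinted c35Y geo9Y (bg9Y 𝔸 G) (fun x => (ops x).Ck) inΛY unitDistY (fun x => (ops x).GivenBy3185)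
      (fun x => (ops x).HasRWExpC))
    (s349 : B9.Stmt349Printed (d + 1) c35Y geo9Y (bg9Y 𝔸 G) (fun x => (ops x).P349))
    (s3132 : B9.Stmt3132Printed (d + 1) c35Y geo9Y (bg9Y 𝔸 G) (fun x => (ops x).QGQinv) (fun x => (ops x).QG1Qinv))
    (t314loc : B9Thm314.Thm314LocalPrinted c35Y geo9Y (bg9Y 𝔸 G) (fun x => (ops x).Kdiff) OmKY dOmegaY) :
    B9LeafX (carriersY d ℓ hd hL b₀ b₁ Mstar 𝔸 G ops) :=
  B9LeafKnit.b9LeafX_of_leaves (carriersY d ℓ hd hL b₀ b₁ Mstar 𝔸 G ops) c35Y_pos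
    (fun x _ hα => reg335Y_one x c35Y_pos hα) (baseU1_carriersY_of_sectC ops t37 t39 t310 hsum hksum) hB hg t37 c38 t39 t310
    hsum hksum t311 t312 t313 t314 t315 s349 s3132 t314loc

end StageY

end Literature.MathematicalPhysics.QuantumFieldTheory.Balaban1983to89.B9BaseU1OfSectC

end
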